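import Summits.HodgeConjecture.CorCM.GaloisTwentyFourDegenerateModels
import Summits.HodgeConjecture.CorCM.GaloisSemidihedralModularNormalForms
import HarnessLib

/-!
# A CM type with a non-trivial RIGHT stabiliser on the Galois group is degenerate; SKEW CM sets (trivial left
# stabiliser, non-trivial right stabiliser) give simple degenerate CM abelian varieties

COR-CM (cell `pub-hodgecm2`), binder seat b04 (gen 23), count-neutral claim CYCLIC-BY-MULTIPLIERS, part I — the
second certificate format of the lineage, next to gen 20's balanced sets
(`GaloisModels.exists_simple_degenerate_of_model_balanced`).  KERNEL ONLY: theorems; no definition, no named fact, no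
`sorry`.  `HC_CM` is neither used nor claimed.

SETTING.  `K/ℚ` Galois CM, `e : Gal(K/ℚ) ≃* G₀` a model, `c₀ = e(c)`, base embedding `φ₀`, `σ_g = φ₀ ∘ g⁻¹`, and a
CM type `Φ` read on `G₀` as `S = {y | σ_{e⁻¹ y} ∈ Φ}`.  `Aut(ℂ)` acts on the embeddings through RIGHT translations of
`S` (gen 20 `GaloisRank.cmTypeRank_eq_typeRank_op`: `Rank(Φ) = typeRank G₀ᵐᵒᵖ S`), while the automorphisms of `K`
act through LEFT translations (Shimura's primitivity criterion: `Φ` primitive iff the left stabiliser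
`{v | v S = S}` is trivial, gen 17 `GaloisTable.exists_isPrimitive_of_tableModel`).

* §1 **`not_isNondegenerate_of_model_mul_right`** — if `S u = S` for some `u ≠ 1` then `Φ` is DEGENERATE: the
  `Aut(ℂ)`-orbit of `Φ` (the right translates `S γ`) has at most `|G₀|/2` members, whereas Shimura's reflex bound
  (tree `IsCMTypeWith.card_le_card_orbit_of_typeRank_eq`, §32.10: `Rank(Φ) ≤ [K* : ℚ]/2 + 1`) forces at least
  `[K : ℚ] = |G₀|` translates for a nondegenerate type.  In field terms: the reflex field of `(K, Φ)` is the fixed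
  field of the right stabiliser, so **a CM type of a Galois CM field whose reflex field is a proper subfield is
  degenerate**.
* §2 **`exists_simple_degenerate_of_model_skew`** — a SKEW CM set `T₀ ⊆ G₀` (`x ∈ T₀ ↔ c₀ x ∉ T₀`, trivial left
  stabiliser, `T₀ u = T₀` for some `u ≠ 1`) is read by a PRIMITIVE DEGENERATE CM type, realised by a SIMPLE CM abelian
  variety of dimension `|G₀|/2` with an exceptional Hodge class on some power (Shimura's existence theorem, Hazama's
  converse — exactly as in gen 20's §1, with the balanced set replaced by the right stabiliser).
* §3 The lineage's non-abelian mechanisms are skew sets: the DOUBLE INTERVAL `{αⁱ, αⁱξ : i < h}` of parts VIII/X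
  (`T₀ ξ = T₀`) and the dihedral MIRROR TYPE `r(S₁) ⊔ sr(−S₁)` of part I (`T₀ · sr 0 = T₀`) — recorded as the
  one-line lemmas `doubleInterval_mul_right` and `mirror_mul_right`.

## References

* [Shimura1998] G. Shimura, *Abelian Varieties with Complex Multiplication and Modular Functions*, §6.2 Thm. 3,
  §8.1, §8.2 Prop. 26, §18.2 Lemma (i), §32.10 (reflex bound `r(φ) ≤ 1 + [K* : ℚ]/2`).
* [Gordon1999HodgeAVSurvey] B. B. Gordon, *A survey of the Hodge conjecture for abelian varieties*, Thm. 6.4, §9.3.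
* [Kubota1965] T. Kubota, Trans. AMS 118 (1965), §2.
-/

noncomputable section

open CategoryTheory CategoryTheory.Limits NumberField MulOpposite
open scoped BigOperators Pointwise

namespace Summit.HodgeConjecture.CorCM.GaloisModels

open Literature.NumberTheory.ComplexMultiplication
open Literature.AlgebraicGeometry.Motives (AbelianVariety CMType)
open Literature.AlgebraicGeometry.HodgeTheory
open Literature.AlgebraicGeometry.ComplexMultiplication (IsCMTypeRealisation)
open Literature.AlgebraicGeometry.Pohlmann1968
open Literature.Barriers.HodgeConjecture (divisorClassesSpan)
open Summit.HodgeConjecture.CorCM.GaloisRank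
open Summit.HodgeConjecture.CorCM.AbelianSixteen (exists_simple_realisation_of_isPrimitive)

variable {K : Type} [Field K] [NumberField K] [IsCMField K]
variable {G₀ : Type*} [Group G₀] [Fintype G₀]

/-! ## §1 A non-trivial right stabiliser makes the type degenerate -/

/-- **A CM type whose set `S ⊆ G₀` on a model of `Gal(K/ℚ)` satisfies `S u = S` for some `u ≠ 1` is DEGENERATE**
(`K/ℚ` Galois CM).  The `Aut(ℂ)`-translates of `Φ` are the right translates `S γ`, at most `|G₀|/2` of them, but a
nondegenerate type has at least `[K:ℚ]` translates (Shimura's reflex bound `r(φ) ≤ 1 + [K* : ℚ]/2`; the reflex field is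
the fixed field of the right stabiliser). [cite: Shimura1998, §32.10] [cite: Kubota1965, §2 (p. 115)] -/
theorem not_isNondegenerate_of_model_mul_right [IsGalois ℚ K] (e : (K ≃ₐ[ℚ] K) ≃* G₀) {c₀ : G₀}
    (hc : e ((IsCMField.complexConj K).restrictScalars ℚ) = c₀) (Φ : CMType K) (φ₀ : K →+* ℂ)
    (S : Finset G₀) (hS : ∀ y : G₀, y ∈ S ↔ embOf φ₀ (e.symm y) ∈ Φ.1) {u : G₀} (hu : u ≠ 1)
    (hSu : ∀ y : G₀, y * u ∈ S ↔ y ∈ S) : ¬ IsNondegenerate Φ := by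
  classical
  intro hnd
  haveI : Nonempty G₀ := ⟨1⟩
  haveI : Finite G₀ᵐᵒᵖ := Finite.of_equiv _ (MulOpposite.opEquiv (α := G₀))
  have hrank := (isNondegenerate_iff_typeRank_op e Φ φ₀ S hS).1 hnd
  have hcm := isCMTypeWith_op e hc Φ φ₀ S hS
  -- Shimura's reflex bound: `|G₀|/2 ≤ |orbit|/2`
  have h1 := hcm.card_le_card_orbit_of_typeRank_eq (1 : G₀) hrank
  -- the right stabiliser of `S` contains `op u ≠ 1`
  set H : Subgroup G₀ᵐᵒᵖ := MulAction.stabilizer G₀ᵐᵒᵖ (↑S : Set G₀) with hH_def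
  have hmem : op u ∈ H := by
    rw [hH_def, MulAction.mem_stabilizer_iff]
    ext y
    rw [Set.mem_smul_set_iff_inv_smul_mem, Finset.mem_coe, Finset.mem_coe, ← MulOpposite.op_inv, op_smul_eq_mul, ← hSu,
      inv_mul_cancel_right]
  have hH1 : H ≠ ⊥ := fun hbot => by
    have : op u = 1 := by rw [hbot, Subgroup.mem_bot] at hmem; exact hmem
    exact hu (op_injective (by rw [this, op_one]))
  have hHcard : 1 < Nat.card H := (H.one_lt_card_iff_ne_bot).2 hH1
  -- orbit–stabiliser: `|orbit| · |H| = |G₀|`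
  have hos : Nat.card (MulAction.orbit G₀ᵐᵒᵖ (↑S : Set G₀)) * Nat.card H = Nat.card G₀ᵐᵒᵖ := by
    rw [hH_def, Nat.card_coe_set_eq, ← MulAction.index_stabilizer, mul_comm, Subgroup.card_mul_index]
  have hG : Nat.card G₀ᵐᵒᵖ = Fintype.card G₀ := by
    rw [Nat.card_congr (MulOpposite.opEquiv (α := G₀)).symm, Nat.card_eq_fintype_card]
  rw [hG] at hos
  -- `|G₀| ≥ 2` (it contains `1 ≠ u`)
  have h2 : 2 ≤ Fintype.card G₀ := by
    rw [← Finset.card_univ]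
    have : ({1, u} : Finset G₀) ⊆ Finset.univ := Finset.subset_univ _
    have hc2 : ({1, u} : Finset G₀).card = 2 := Finset.card_pair (Ne.symm hu)
    exact hc2 ▸ Finset.card_le_card this
  -- arithmetic: `|orbit| ≤ |G₀|/2` contradicts `|G₀|/2 ≤ |orbit|/2`
  set o := Nat.card (MulAction.orbit G₀ᵐᵒᵖ (↑S : Set G₀)) with ho_def
  have hle : 2 * o ≤ Fintype.card G₀ := by
    rw [← hos]
    exact Nat.mul_le_mul_left o hHcard |>.trans_eq' (by ring)
  omega

/-! ## §2 Skew CM sets: primitive degenerate CM types and simple degenerate abelian varieties -/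

/-- **Skew certificate ⟹ primitive degenerate CM type.**  `e : Gal(K/ℚ) ≃* G₀`, `c₀ = e(c)`; a CM set `T₀ ⊆ G₀`
(`x ∈ T₀ ↔ c₀ x ∉ T₀`) with trivial LEFT stabiliser and `T₀ u = T₀` for some `u ≠ 1`.  Then `K` has a PRIMITIVE
DEGENERATE CM type. [cite: Shimura1998, §8.2 Prop. 26 and §32.10] -/
theorem exists_isPrimitive_not_isNondegenerate_of_model_skew [IsGalois ℚ K] (e : (K ≃ₐ[ℚ] K) ≃* G₀) (c₀ : G₀)
    (hc : e ((IsCMField.complexConj K).restrictScalars ℚ) = c₀) (T₀ : Finset G₀)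
    (hcm : ∀ x : G₀, x ∈ T₀ ↔ c₀ * x ∉ T₀) (hprim : ∀ v : G₀, v ≠ 1 → ∃ w : G₀, ¬ (w ∈ T₀ ↔ v * w ∈ T₀))
    {u : G₀} (hu : u ≠ 1) (hTu : ∀ x : G₀, x * u ∈ T₀ ↔ x ∈ T₀) (φ₀ : K →+* ℂ) :
    ∃ Φ : CMType K, IsPrimitive (ℂ ≃+* ℂ) Φ.1 φ₀ ∧ ¬ IsNondegenerate Φ := by
  classical
  obtain ⟨Φ, hprimΦ, hread⟩ := GaloisTable.exists_isPrimitive_of_tableModel (K := K) (X := G₀)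
    (fun y z => y * z) e.toEquiv (fun _ _ => map_mul e _ _) c₀ hc 1 (map_one e) T₀ hcm hprim φ₀
  exact ⟨Φ, hprimΦ, not_isNondegenerate_of_model_mul_right e hc Φ φ₀ T₀ (fun y => hread y) hu hTu⟩

/-- **… realised: a SIMPLE DEGENERATE CM abelian variety of dimension `|G₀|/2 = [K:ℚ]/2`** with an exceptional
Hodge class on some power, from a skew CM set on a model of the Galois group. [cite: Shimura1998, §6.2 Thm. 3 and
§8.2 Prop. 26] [cite: Gordon1999HodgeAVSurvey, Thm. 6.4] -/
theorem exists_simple_degenerate_of_model_skew [IsGalois ℚ K] (e : (K ≃ₐ[ℚ] K) ≃* G₀) (c₀ : G₀)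
    (hc : e ((IsCMField.complexConj K).restrictScalars ℚ) = c₀) (T₀ : Finset G₀)
    (hcm : ∀ x : G₀, x ∈ T₀ ↔ c₀ * x ∉ T₀) (hprim : ∀ v : G₀, v ≠ 1 → ∃ w : G₀, ¬ (w ∈ T₀ ↔ v * w ∈ T₀))
    {u : G₀} (hu : u ≠ 1) (hTu : ∀ x : G₀, x * u ∈ T₀ ↔ x ∈ T₀) :
    ∃ (Φ : CMType K) (φ₀ : K →+* ℂ) (A : AbelianVariety ℂ) (ι : 𝓞 K →+* End A)
      (θ : K →+* Module.End ℂ (complexBetti A.X 1)),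
      IsPrimitive (ℂ ≃+* ℂ) Φ.1 φ₀ ∧ ¬ IsNondegenerate Φ ∧ IsCMTypeRealisation Φ A ι θ ∧ A.IsSimple ∧
      A.dim = Fintype.card G₀ / 2 ∧
      ∃ n p : ℕ, ∃ x : complexBetti (⨁ fun _ : Fin n => A).X (2 * p), IsRationalClass x ∧
        IsOfHodgeType (⨁ fun _ : Fin n => A).dim (⨁ fun _ : Fin n => A).X (2 * p) p p x ∧
        x ∉ divisorClassesSpan (⨁ fun _ : Fin n => A).X (⨁ fun _ : Fin n => A).dim p := by
  obtain ⟨φ₀⟩ := (inferInstance : Nonempty (K →+* ℂ))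
  obtain ⟨Φ, hprimΦ, hdeg⟩ :=
    exists_isPrimitive_not_isNondegenerate_of_model_skew e c₀ hc T₀ hcm hprim hu hTu φ₀
  obtain ⟨A, ι, θ, hA, hs, hdim⟩ := exists_simple_realisation_of_isPrimitive Φ φ₀ hprimΦ
  refine ⟨Φ, φ₀, A, ι, θ, hprimΦ, hdeg, hA, hs, ?_, exists_exceptional_pow_of_not_isNondegenerate φ₀ hprimΦ hdeg hA⟩
  rw [hdim, card_model_eq_finrank e]

/-! ## §3 The lineage's mechanisms are skew sets -/

section Instances

variable {G : Type*} [Group G] {α ξ : G} {h : ℕ} {T : Finset G}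

/-- **The double interval is right-`ξ`-invariant** (`ξ² = 1`): `(αˣ)ξ = αˣξ` and `(αˣξ)ξ = αˣ` have the same
exponent, so membership (`x.val < h` on both sheets) is unchanged — parts VIII/X of gen 22 are skew certificates.
[folklore] -/
theorem doubleInterval_mul_right [Fintype G] [NeZero h] (hord : orderOf α = 2 * h)
    (hξ : ξ ∉ Subgroup.zpowers α) (hξ2 : ξ * ξ = 1) (hcard : Fintype.card G = 4 * h)
    (hTr : ∀ x : ZMod (2 * h), α ^ x.val ∈ T ↔ x.val < h)
    (hTx : ∀ x : ZMod (2 * h), α ^ x.val * ξ ∈ T ↔ x.val < h) (g : G) : g * ξ ∈ T ↔ g ∈ T := by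
  obtain ⟨x, rfl | rfl⟩ := GaloisSemidihedral.exists_normalForm hord hξ hcard g
  · rw [hTx, hTr]
  · rw [mul_assoc, hξ2, mul_one, hTr, hTx]

/-- **The mirror type with `t = 0` is right-invariant under the reflection `sr 0`**: in `DihedralGroup m`,
`r i · sr 0 = sr (−i)` and `sr i · sr 0 = r (−i)`, so `T = r(S₁) ⊔ {sr k : −k ∈ S₁}` satisfies `T · sr 0 = T` —
the dihedral mirror types of gen 22 part I are skew certificates. [folklore] -/
theorem mirror_mul_right {m : ℕ} {S₁ : Finset (ZMod m)} {T : Finset (DihedralGroup m)}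
    (hTr : ∀ i : ZMod m, DihedralGroup.r i ∈ T ↔ i ∈ S₁)
    (hTs : ∀ k : ZMod m, DihedralGroup.sr k ∈ T ↔ -k ∈ S₁) (g : DihedralGroup m) :
    g * DihedralGroup.sr 0 ∈ T ↔ g ∈ T := by
  rcases g with i | i
  · rw [DihedralGroup.r_mul_sr, zero_sub, hTs, neg_neg, hTr]
  · rw [DihedralGroup.sr_mul_sr, zero_sub, hTr, hTs]

end Instances

end Summit.HodgeConjecture.CorCM.GaloisModels

end
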